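import Literature.NumberTheory.GelbartRogawski1991.CompatibleSplittingCMDoubling
import Literature.NumberTheory.GelbartRogawski1991.DoubledWeilRepresentationArchHalf
import Literature.NumberTheory.GelbartRogawski1991.DoubledWeilRepresentationLocalFamilyCM
import HarnessLib

/-!
# The compatible splitting ATTACHED TO A PRESCRIBED Hecke character, as a TERM, and its transport to a hermitian line

[GelbartRogawski1991, §3.1 Prop. 3.1.1 p. 455 L1–2] asserts the EXISTENCE of a compatible splitting
`s : G₁(𝔸) → Mp_𝔸(𝕎)` of the unitary dual pair; its proof in print — and the tree's doubling construction
(`DoubledUnitaryGlobalSplittingData`, `DoubledWeilRepresentation*`, `CompatibleSplittingCMDoubling`) — produces a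
SPECIFIC one: the restriction to `G₁ = U(𝕍) ↪ H = U(𝕍 ⊕ (−𝕍))` (`g ↦ g ⊕ 1`) of the Weil representation of the
doubled group normalised on the Siegel parabolic `P_Δ(𝔸)` by a Hecke character `χ` of `L` with
`χ|_{𝕀_{L⁺}} = ε_{L/L⁺}` ([Kudla1994, §§1–3, Thm. 3.1]; [HarrisKudlaSweet1996, §1 (1.14)–(1.15), Cor. A.3 p. 998:
"`ι̃_{V,χ}` … determined by doubling"]).  This is the splitting `ι_μ` that [Liu2021, App. D §D.1 Step 2 (arXiv p. 56;
FJcycle.tex l. 5219)] attaches to the character `μ` ("the induced homomorphism `ι_μ : U(V) → Mp(V_ε)` (see, for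
example, [HKS] Section 1). Put `ω(μ, ε) := ω(ε) ∘ ι_μ`"), with `χ := μ` itself (Liu's `μ|_{F^×}` = the quadratic
character of `E/F`, i.e. `IsSplittingChar L 1 μ`; tree `Liu2021.OscillatorConventions.IsOscillatorChar`).

The tree so far exposes this splitting only through the `∃`-statement `SplittingDatum.CompatibleSplitting`
(`compatibleSplitting_of_isDoubledWeilRep`, `gru_body_of`, `gru_shape_of`), after which a consumer can only CHOOSE
some compatible splitting (`UnitaryDualPair.splittingOf`) — and two compatible splittings differ by a character
`ν ∘ det` ([GelbartRogawski1991, Remark p. 457]; tree `SplittingDatum.IsCompatible.exists_central_twist`), so the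
`χ`-attachment is lost at that `∃`.  This file keeps it:

* §1 `splittingCongr` — transport of a splitting homomorphism (DATA) along equal W-side Gram data
  `T_W = T_W'`, `J_W = J_W'` (the carrier types of `splittingDatum … J_W … T_W …` depend on them), with
  `IsCompatible`, `Continuous` and `Continuous ∘ pairSplitting` riding along (`subst`; proof arguments by proof
  irrelevance);
* §2 `isCompatible_undoubleHom` — for ANY Hecke character `χ` and any doubled Weil representation
  `sD` normalised by `χ` (`IsDoubledWeilRep χ sD`), the undoubled homomorphism `undoubleHom sD` IS a compatible
  splitting of the datum of record (the body of `compatibleSplitting_of_isDoubledWeilRep` without its `∃`: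
  `proj_undouble`, `undouble_mem_range_ratSection`, `S3'_propagate ∘ S3_parabolic_rational ∘
  S2_ratH_normalClosure_siegel ∘ inlG_rational`);
* §3 `exists_isDoubledWeilRep` — for every UNITARY Hecke character `χ` with `IsSplittingChar L 1 χ`
  a `χ`-normalised doubled Weil representation EXISTS, hypothesis-free (tree: the per-place family
  `nonempty_finLocalFamily`, the archimedean half `exists_isArchHalf`, assembled by
  `isDoubledWeilRep_of_family_of_archHalf`; Haar data are auxiliary — any choice); `doubledWeilRep χ` := a witness
  (a RIGID `∃`: the predicate records the `χ`-normalisation on `P_Δ(𝔸)`, which pins the splitting in print —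
  [Kudla1994, Thm. 3.1]; no uniqueness theorem is claimed here) and **`chiSplitting χ`** := `undoubleHom
  (doubledWeilRep χ)`: THE compatible splitting of `U(diag dV ⊗ diag dW)(𝔸)` attached to `χ`, continuous, with
  continuous pair splitting;
* §4 the HERMITIAN LINE `W = ⟨T_W⟩`, `T_W ∈ M₁(L⁺)` symmetric of unit determinant, `J_W = T_W ⊗ L` (the W-slot of
  [Liu2021, Def. 4.11 / App. D Step 1], `dim W = 1`): `lineW T_W := (T_W · ·)` with `realDiagonal (lineW T_W) = T_W`,
  `diagonal (lineW T_W) = J_W`, and **`chiSplittingLine χ T_W J_W`** : the `χ`-attached splitting transported to the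
  datum `splittingDatum L⁺ L c̄ N 1 e (diagonal dV) J_W … hW … hWd … hJW` for ARBITRARY proof arguments
  `hW / hWd / hJW`, with `isCompatible_chiSplittingLine` and `continuous_pairSplitting_chiSplittingLine` — by
  application exactly the three inputs `s / hs / hsc` (splitting family, compatible, pair splitting continuous) of a
  consumer that reads the Weil representation of `U(diag dV) × U(⟨a⟩)` at the splitting attached to a character.

Everything is a definition by composition of tree constructions or a theorem; no fact is asserted; the three named
inputs of Prop. 3.1.1's proof (per-place package, archimedean half, undoubling) are the tree's theorems.  Checkable
guard: no declaration here mentions `CompatibleSplitting`, `splittingOf` or `exists_isUnitary_isSplittingChar_one`;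
the character `χ` is a parameter of every declaration of §§2–4.

References: S. Gelbart, J. Rogawski, *L-functions and Fourier–Jacobi coefficients for the unitary group U(3)*,
Invent. Math. 105 (1991), §3.1 pp. 454–457 [GelbartRogawski1991]; S. Kudla, *Splitting metaplectic covers of dual
reductive pairs*, Israel J. Math. 87 (1994), §§1–3, Thm. 3.1 [Kudla1994]; M. Harris, S. Kudla, W. J. Sweet, *Theta
dichotomy for unitary groups*, J. Amer. Math. Soc. 9 (1996), §1 (1.14)–(1.16), Cor. A.3 [HarrisKudlaSweet1996];
Y. Liu, *Fourier–Jacobi cycles and arithmetic relative trace formula*, Camb. J. Math. 9 (2021) = arXiv:2102.11518,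
Def. 4.11, App. D §D.1 Steps 1–2 (FJcycle.tex l. 5217–5219) [Liu2021].
-/

set_option autoImplicit false

noncomputable section

open scoped Classical
open scoped Matrix Kronecker TensorProduct
open NumberField IsDedekindDomain
open Literature.RepresentationTheory.HeisenbergGroup
open Literature.NumberTheory.Automorphic
open Literature.NumberTheory.Weil1964
open Literature.RepresentationTheory.HarrisKudlaSweet1996
open Literature.NumberTheory.GaloisRepresentations

/-! ## §1  Transport of a splitting homomorphism along equal W-side Gram data -/

namespace Literature.NumberTheory.Automorphic.Liu2021.Def411WeilCarriersDoubling

open Literature.NumberTheory.GelbartRogawski1991 Literature.NumberTheory.GelbartRogawski1991.UnitaryDualPair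
open Literature.NumberTheory.GelbartRogawski1991.GRConstruction

section Congr

variable (F E : Type) [Field F] [NumberField F] [Field E] [NumberField E] [Algebra F E]
variable (c : E ≃ₐ[F] E) (N M : ℕ) {n : ℕ} (e : Fin N × Fin M ≃ Fin n)
variable (JV : Matrix (Fin N) (Fin N) E) {TV : Matrix (Fin N) (Fin N) F}
variable {TW TW' : Matrix (Fin M) (Fin M) F} {JW JW' : Matrix (Fin M) (Fin M) E}

/-- **Transport of a splitting homomorphism along equal W-side Gram data** `T_W = T_W'`, `J_W = J_W'` (the groups
`G₁(𝔸) = U(J_V ⊗ J_W)(𝔸)` and `Mp_ψ(𝕎_𝔸)ᶜᵒⁿᵗ`, `𝕎` with Gram matrix `T_V ⊗ T_W`, depend on them). [folklore] -/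
def splittingCongr (hT : TW = TW') (hJ : JW = JW')
    (s : UnitaryGroup.adelicPair F E c N M JV JW →* adelicMpCont F (Fin n) (adelicGram F e TV TW)) :
    UnitaryGroup.adelicPair F E c N M JV JW' →* adelicMpCont F (Fin n) (adelicGram F e TV TW') := by
  subst hT hJ
  exact s

/-- transport along `rfl, rfl` is the identity. [cite: GelbartRogawski1991, §3.1 Prop. 3.1.1 p. 455 L1–3] -/
@[simp] theorem splittingCongr_rfl
    (s : UnitaryGroup.adelicPair F E c N M JV JW →* adelicMpCont F (Fin n) (adelicGram F e TV TW)) :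
    splittingCongr F E c N M e JV rfl rfl s = s := rfl

/-- a continuous splitting stays continuous. [cite: GelbartRogawski1991, §3.1 Prop. 3.1.1 p. 455 L1–3] -/
theorem continuous_splittingCongr (hT : TW = TW') (hJ : JW = JW')
    {s : UnitaryGroup.adelicPair F E c N M JV JW →* adelicMpCont F (Fin n) (adelicGram F e TV TW)}
    (hc : Continuous s) : Continuous (splittingCongr F E c N M e JV hT hJ s) := by
  subst hT hJ
  exact hc

/-- the pair splitting `s_pair (x, y) = s(x ⊗ 1) s(1 ⊗ y)` of the transported splitting is continuous if that of
`s` is. [cite: GelbartRogawski1991, §3.1 Prop. 3.1.1 p. 455 L1–3] -/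
theorem continuous_pairSplitting_splittingCongr (hT : TW = TW') (hJ : JW = JW')
    {s : UnitaryGroup.adelicPair F E c N M JV JW →* adelicMpCont F (Fin n) (adelicGram F e TV TW)}
    (hsc : Continuous (pairSplitting F E c N M e JV JW s)) :
    Continuous (pairSplitting F E c N M e JV JW' (splittingCongr F E c N M e JV hT hJ s)) := by
  subst hT hJ
  exact hsc

set_option maxHeartbeats 2000000 in
-- (the `subst` motive carries the whole `splittingDatum` telescope)
/-- **compatibility is transported**: if `s` is a compatible splitting of the datum at `(T_W, J_W)` then
`splittingCongr hT hJ s` is one of the datum at `(T_W', J_W')`, for ANY proof arguments `hW' / hWd' / hJW'` of the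
latter (proof irrelevance). [cite: GelbartRogawski1991, §3.1 Prop. 3.1.1 p. 455 L1–3; Remark p. 457 L4] -/
theorem isCompatible_splittingCongr [Algebra.IsQuadraticExtension F E] {δ : E} (hcδ : c δ = -δ) (hδ : δ ≠ 0)
    {d : F} (hd : δ * δ = algebraMap F E d) (hV : TV.IsSymm) (hVd : IsUnit TV.det)
    (hJV : JV = TV.map (algebraMap F E)) (hT : TW = TW') (hJ : JW = JW')
    (hW : TW.IsSymm) (hW' : TW'.IsSymm) (hWd : IsUnit TW.det) (hWd' : IsUnit TW'.det)
    (hJW : JW = TW.map (algebraMap F E)) (hJW' : JW' = TW'.map (algebraMap F E))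
    {s : UnitaryGroup.adelicPair F E c N M JV JW →* adelicMpCont F (Fin n) (adelicGram F e TV TW)}
    (hs : (splittingDatum F E c N M e JV JW hcδ hδ hd hV hW hVd hWd hJV hJW).IsCompatible s) :
    (splittingDatum F E c N M e JV JW' hcδ hδ hd hV hW' hVd hWd' hJV hJW').IsCompatible
      (splittingCongr F E c N M e JV hT hJ s) := by
  subst hT hJ
  exact hs

end Congr

section CM

variable (L : Type) [Field L] [NumberField L] [IsCMField L]

variable {N M n : ℕ} (e : Fin N × Fin M ≃ Fin n)
  (dV : Fin N → L) (hdV : ∀ i, IsCMField.complexConj L (dV i) = dV i) (hdV0 : ∀ i, dV i ≠ 0)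
  (dW : Fin M → L) (hdW : ∀ i, IsCMField.complexConj L (dW i) = dW i) (hdW0 : ∀ i, dW i ≠ 0)

/-! ## §2  The undoubled homomorphism of a `χ`-normalised doubled Weil representation IS a compatible splitting -/

section Undouble

/-- **`undoubleHom sD` is compatible** ((3.1.1)–(3.1.2) of the datum of record: `π ∘ s = ι` and
`s(G₁(L⁺)) ⊆ r_F(Sp_F(𝕎))`) for every Hecke character `χ` and every `χ`-normalised doubled Weil representation `sD`
— the `∃`-free body of `compatibleSplitting_of_isDoubledWeilRep`.
[cite: GelbartRogawski1991, §3.1 Prop. 3.1.1 p. 455 L1–2] [cite: Kudla1994, §2 (doubled space, Siegel parabolic), Thm. 3.1] -/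
theorem isCompatible_undoubleHom (χ : HeckeCharacter L) {sD : HA L e dV hdV dW hdW →* MpD L e dV hdV dW hdW}
    (hs : IsDoubledWeilRep L e dV hdV hdV0 dW hdW hdW0 χ sD) :
    (D L e dV hdV hdV0 dW hdW hdW0).IsCompatible (undoubleHom L e dV hdV hdV0 dW hdW hdW0 sD hs.proj_eq) :=
  ⟨fun g => proj_undouble L e dV hdV hdV0 dW hdW hdW0 hs.proj_eq g,
    fun γ hγ => undouble_mem_range_ratSection L e dV hdV hdV0 dW hdW hdW0 hs.proj_eq (fun γ' hγ' =>
      S3'_propagate L e dV hdV hdV0 dW hdW hdW0 χ hs (S3_parabolic_rational L e dV hdV hdV0 dW hdW hdW0 χ hs)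
        (S2_ratH_normalClosure_siegel L e dV hdV hdV0 dW hdW hdW0) _ (inlG_rational L e dV hdV dW hdW γ' hγ')) γ hγ⟩

/-- its pair splitting is continuous. [cite: GelbartRogawski1991, §3.1 Prop. 3.1.1 p. 455 L1–2] -/
theorem continuous_pairSplitting_undoubleHom {sD : HA L e dV hdV dW hdW →* MpD L e dV hdV dW hdW} (hc : Continuous sD)
    (hproj : ∀ h, projD L e dV hdV dW hdW (sD h) = toSpD L e dV hdV dW hdW h) :
    Continuous (pairSplitting (Fp L) L (IsCMField.complexConj L) N M e (Matrix.diagonal dV) (Matrix.diagonal dW)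
      (undoubleHom L e dV hdV hdV0 dW hdW hdW0 sD hproj)) :=
  continuous_pairSplitting (Fp L) L (IsCMField.complexConj L) N M e (Matrix.diagonal dV) (Matrix.diagonal dW)
    (continuous_undoubleHom L e dV hdV hdV0 dW hdW hdW0 hc hproj)

end Undouble

/-! ## §3  The `χ`-normalised doubled Weil representation EXISTS (hypothesis-free) and the splitting attached to `χ` -/

section Chi

/-- auxiliary Haar data at the finite places of `L⁺` (any choice; the per-place package exists for every choice,
`nonempty_finLocalFamily`). [folklore] -/
def haarData : ∀ v : HeightOneSpectrum (𝓞 (Fp L)), PlaceMeasure L v :=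
  fun v => Classical.choice (nonempty_placeMeasure L v)

/-- **a `χ`-normalised doubled Weil representation exists** for every unitary Hecke character `χ` of the CM field
`L` with `χ|_{𝕀_{L⁺}} = ε_{L/L⁺}`: the per-place package (`nonempty_finLocalFamily`) and the archimedean half
(`exists_isArchHalf`) assembled (`isDoubledWeilRep_of_family_of_archHalf`) — the three steps of the proof of
Prop. 3.1.1 in print, all theorems of the tree.
[cite: GelbartRogawski1991, §3.1 Prop. 3.1.1 p. 455 L1–2] [cite: Kudla1994, §2 (doubled space, Siegel parabolic), Thm. 3.1] -/
theorem exists_isDoubledWeilRep (χ : HeckeCharacter L) (hχu : χ.IsUnitary) (hχs : IsSplittingChar L 1 χ) :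
    ∃ sD : HA L e dV hdV dW hdW →* MpD L e dV hdV dW hdW, IsDoubledWeilRep L e dV hdV hdV0 dW hdW hdW0 χ sD :=
  isDoubledWeilRep_of_family_of_archHalf L e dV hdV hdV0 dW hdW hdW0 χ (haarData L)
    (nonempty_finLocalFamily L e dV hdV hdV0 dW hdW hdW0 χ hχs (haarData L))
    (exists_isArchHalf L e dV hdV hdV0 dW hdW hdW0 χ hχu hχs)

/-- **the doubled Weil representation attached to `χ`**, `s^𝔻_χ : H(𝔸) →* Mp(𝕎^𝔻)ᶜᵒⁿᵗ` (a witness of the rigid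
`∃` of `exists_isDoubledWeilRep`: the predicate records the normalisation by `χ` on `P_Δ(𝔸)`).
[cite: Kudla1994, §2 (doubled space, Siegel parabolic), Thm. 3.1] [cite: HarrisKudlaSweet1996, §1 (1.14)–(1.15)] -/
def doubledWeilRep (χ : HeckeCharacter L) (hχu : χ.IsUnitary) (hχs : IsSplittingChar L 1 χ) :
    HA L e dV hdV dW hdW →* MpD L e dV hdV dW hdW :=
  Classical.choose (exists_isDoubledWeilRep L e dV hdV hdV0 dW hdW hdW0 χ hχu hχs)

/-- `doubledWeilRep χ` is a `χ`-normalised doubled Weil representation (continuous, over `ι^𝔻`, parabolic clause).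
[cite: Kudla1994, §2 (doubled space, Siegel parabolic), Thm. 3.1] -/
theorem isDoubledWeilRep_doubledWeilRep (χ : HeckeCharacter L) (hχu : χ.IsUnitary) (hχs : IsSplittingChar L 1 χ) :
    IsDoubledWeilRep L e dV hdV hdV0 dW hdW hdW0 χ (doubledWeilRep L e dV hdV hdV0 dW hdW hdW0 χ hχu hχs) :=
  Classical.choose_spec (exists_isDoubledWeilRep L e dV hdV hdV0 dW hdW hdW0 χ hχu hχs)

/-- **the compatible splitting attached to `χ`**, `s_χ := (s^𝔻_χ)|_{G₁ ⊕ 1}` undoubled: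
`G₁(𝔸) = U(diag dV ⊗ diag dW)(𝔸_{L⁺}) →* Mp_ψ(𝕎_𝔸)ᶜᵒⁿᵗ` — [HarrisKudlaSweet1996]'s `ι̃_{V,χ}` "determined by
doubling", [Liu2021, App. D Step 2]'s `ι_μ` at `χ = μ`.
[cite: Kudla1994, §2 (doubled space, Siegel parabolic), Thm. 3.1] [cite: HarrisKudlaSweet1996, §1 (1.14)–(1.15), Cor. A.3 p. 998] [cite: Liu2021, App. D §D.1 Step 2 (l. 5219)] -/
def chiSplitting (χ : HeckeCharacter L) (hχu : χ.IsUnitary) (hχs : IsSplittingChar L 1 χ) :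
    UnitaryGroup.adelicPair (Fp L) L (IsCMField.complexConj L) N M (Matrix.diagonal dV) (Matrix.diagonal dW) →*
      adelicMpCont (Fp L) (Fin n) (gramA L e dV hdV dW hdW) :=
  undoubleHom L e dV hdV hdV0 dW hdW hdW0 (doubledWeilRep L e dV hdV hdV0 dW hdW hdW0 χ hχu hχs)
    (isDoubledWeilRep_doubledWeilRep L e dV hdV hdV0 dW hdW hdW0 χ hχu hχs).proj_eq

/-- `s_χ` is a compatible splitting of the datum of record ((3.1.1)–(3.1.2)).
[cite: GelbartRogawski1991, §3.1 Prop. 3.1.1 p. 455 L1–2] -/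
theorem isCompatible_chiSplitting (χ : HeckeCharacter L) (hχu : χ.IsUnitary) (hχs : IsSplittingChar L 1 χ) :
    (D L e dV hdV hdV0 dW hdW hdW0).IsCompatible (chiSplitting L e dV hdV hdV0 dW hdW hdW0 χ hχu hχs) :=
  isCompatible_undoubleHom L e dV hdV hdV0 dW hdW hdW0 χ (isDoubledWeilRep_doubledWeilRep L e dV hdV hdV0 dW hdW hdW0 χ hχu hχs)

/-- `s_χ` is continuous. [cite: GelbartRogawski1991, §3.1 Prop. 3.1.1 p. 455 L1–2] -/
theorem continuous_chiSplitting (χ : HeckeCharacter L) (hχu : χ.IsUnitary) (hχs : IsSplittingChar L 1 χ) :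
    Continuous (chiSplitting L e dV hdV hdV0 dW hdW hdW0 χ hχu hχs) :=
  continuous_undoubleHom L e dV hdV hdV0 dW hdW hdW0 (isDoubledWeilRep_doubledWeilRep L e dV hdV hdV0 dW hdW hdW0 χ hχu hχs).continuous _

/-- the pair splitting of `s_χ` is continuous. [cite: GelbartRogawski1991, §3.1 Prop. 3.1.1 p. 455 L1–2] -/
theorem continuous_pairSplitting_chiSplitting (χ : HeckeCharacter L) (hχu : χ.IsUnitary) (hχs : IsSplittingChar L 1 χ) :
    Continuous (pairSplitting (Fp L) L (IsCMField.complexConj L) N M e (Matrix.diagonal dV) (Matrix.diagonal dW)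
      (chiSplitting L e dV hdV hdV0 dW hdW hdW0 χ hχu hχs)) :=
  continuous_pairSplitting_undoubleHom L e dV hdV hdV0 dW hdW hdW0
    (isDoubledWeilRep_doubledWeilRep L e dV hdV hdV0 dW hdW hdW0 χ hχu hχs).continuous _

end Chi

/-! ## §4  The hermitian LINE `W = ⟨T_W⟩`, `T_W ∈ M₁(L⁺)`: the `χ`-attached splitting at the line datum -/

section Line

/-- the entry family of a `1 × 1` Gram matrix `T_W` over `L⁺`, read in `L`: the lane's `dW` for the line `⟨T_W⟩`.
[cite: Liu2021, Def. 4.11 (l. 2088) and App. D §D.1 Step 1 (l. 5217)] -/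
def lineW (TW : Matrix (Fin 1) (Fin 1) (Fp L)) : Fin 1 → L := fun i => ((TW i i : Fp L) : L)

/-- the entries of `T_W ∈ M₁(L⁺)` are fixed by complex conjugation. [cite: Liu2021, App. D §D.1 Step 1 (l. 5217)] [cite: GelbartRogawski1991, §3.1 p. 454] -/
theorem complexConj_lineW (TW : Matrix (Fin 1) (Fin 1) (Fp L)) (i : Fin 1) :
    IsCMField.complexConj L (lineW L TW i) = lineW L TW i :=
  (IsCMField.complexConj_eq_self_iff (K := L) _).2 (TW i i).2

omit [NumberField L] [IsCMField L] in
/-- the entry of `T_W` is non-zero when `det T_W` is a unit (`det` of a `1 × 1` matrix is its entry). [cite: Liu2021, App. D §D.1 Step 1 (l. 5217)] [cite: GelbartRogawski1991, §3.1 p. 454] -/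
theorem lineW_ne_zero (TW : Matrix (Fin 1) (Fin 1) (Fp L)) (hWd : IsUnit TW.det) (i : Fin 1) : lineW L TW i ≠ 0 := by
  intro h0
  obtain rfl : i = 0 := Subsingleton.elim _ _
  have h0' : ((TW 0 0 : Fp L) : L) = 0 := h0
  have h00 : TW 0 0 = 0 := by exact_mod_cast h0'
  have hdet : TW.det = 0 := by rw [Matrix.det_fin_one, h00]
  exact not_isUnit_zero (hdet ▸ hWd)

/-- `realDiagonal (lineW T_W) = T_W`: a `1 × 1` matrix over `L⁺` is the real diagonal matrix of its entry.
[cite: Liu2021, App. D §D.1 Step 1 (l. 5217)] [cite: GelbartRogawski1991, §3.1 p. 454] -/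
theorem realDiagonal_lineW (TW : Matrix (Fin 1) (Fin 1) (Fp L)) :
    realDiagonal L (lineW L TW) (complexConj_lineW L TW) = TW := by
  ext i j
  obtain rfl : i = j := Subsingleton.elim _ _
  simp [realDiagonal, lineW, Matrix.diagonal]

omit [NumberField L] [IsCMField L] in
/-- `diagonal (lineW T_W) = J_W` for `J_W = T_W ⊗_{L⁺} L`. [cite: Liu2021, App. D §D.1 Step 1 (l. 5217)] [cite: GelbartRogawski1991, §3.1 p. 454] -/
theorem diagonal_lineW (TW : Matrix (Fin 1) (Fin 1) (Fp L)) {JW : Matrix (Fin 1) (Fin 1) L}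
    (hJW : JW = TW.map (algebraMap (Fp L) L)) : Matrix.diagonal (lineW L TW) = JW := by
  subst hJW
  ext i j
  obtain rfl : i = j := Subsingleton.elim _ _
  rw [Matrix.diagonal_apply_eq, Matrix.map_apply]
  rfl

variable {N' n' : ℕ} (e₁ : Fin N' × Fin 1 ≃ Fin n')
  (dV₁ : Fin N' → L) (hdV₁ : ∀ i, IsCMField.complexConj L (dV₁ i) = dV₁ i) (hdV₁0 : ∀ i, dV₁ i ≠ 0)

/-- **the splitting attached to `χ` at the hermitian line `⟨T_W⟩`**: `s_χ` of the lane's datum at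
`dW := lineW T_W`, transported to the line datum over `(diagonal dV, J_W)` with W-Gram matrix `T_W` —
`G₁(𝔸) = U(diag dV ⊗ J_W)(𝔸_{L⁺}) →* Mp_ψ(𝕎_𝔸)ᶜᵒⁿᵗ`, `𝕎` with Gram matrix `diag(dV) ⊗ T_W`.  At `χ := μ` this is
[Liu2021, App. D Step 2]'s `ι_μ` for the pair `(V, W₁)` of Step 1.
[cite: Liu2021, App. D §D.1 Steps 1–2 (l. 5217–5219)] [cite: HarrisKudlaSweet1996, §1 (1.14)–(1.15), Cor. A.3 p. 998] [cite: Kudla1994, §2 (doubled space, Siegel parabolic), Thm. 3.1] -/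
def chiSplittingLine (χ : HeckeCharacter L) (hχu : χ.IsUnitary) (hχs : IsSplittingChar L 1 χ)
    (TW : Matrix (Fin 1) (Fin 1) (Fp L)) (hWd : IsUnit TW.det) (JW : Matrix (Fin 1) (Fin 1) L)
    (hJW : JW = TW.map (algebraMap (Fp L) L)) :
    UnitaryGroup.adelicPair (Fp L) L (IsCMField.complexConj L) N' 1 (Matrix.diagonal dV₁) JW →*
      adelicMpCont (Fp L) (Fin n') (adelicGram (Fp L) e₁ (realDiagonal L dV₁ hdV₁) TW) :=
  splittingCongr (Fp L) L (IsCMField.complexConj L) N' 1 e₁ (Matrix.diagonal dV₁) (realDiagonal_lineW L TW)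
    (diagonal_lineW L TW hJW)
    (chiSplitting L e₁ dV₁ hdV₁ hdV₁0 (lineW L TW) (complexConj_lineW L TW) (lineW_ne_zero L TW hWd) χ hχu hχs)

set_option maxHeartbeats 2000000 in
-- (one `subst` through the `splittingDatum` telescope, as in §1)
/-- **`s_χ` at the line is a compatible splitting of the LINE datum** `splittingDatum L⁺ L c̄ N 1 e (diagonal dV) J_W
(complexConj_imagUnit) (imagUnit_ne_zero) (imagUnit_mul_self) (realDiagonal_isSymm …) hW (isUnit_det_realDiagonal …)
hWd (realDiagonal_map …).symm hJW` — for ANY proofs `hW`, `hWd`, `hJW` the consumer carries.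
[cite: GelbartRogawski1991, §3.1 Prop. 3.1.1 p. 455 L1–3] [cite: Liu2021, App. D §D.1 Step 2 (l. 5219)] -/
theorem isCompatible_chiSplittingLine (χ : HeckeCharacter L) (hχu : χ.IsUnitary) (hχs : IsSplittingChar L 1 χ)
    (TW : Matrix (Fin 1) (Fin 1) (Fp L)) (hW : TW.IsSymm) (hWd : IsUnit TW.det) (JW : Matrix (Fin 1) (Fin 1) L)
    (hJW : JW = TW.map (algebraMap (Fp L) L)) :
    (splittingDatum (Fp L) L (IsCMField.complexConj L) N' 1 e₁ (Matrix.diagonal dV₁) JW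
        (complexConj_imagUnit L) (imagUnit_ne_zero L) (imagUnit_mul_self L) (realDiagonal_isSymm L dV₁ hdV₁) hW
        (isUnit_det_realDiagonal L dV₁ hdV₁ hdV₁0) hWd (realDiagonal_map L dV₁ hdV₁).symm hJW).IsCompatible
      (chiSplittingLine L e₁ dV₁ hdV₁ hdV₁0 χ hχu hχs TW hWd JW hJW) :=
  isCompatible_splittingCongr (Fp L) L (IsCMField.complexConj L) N' 1 e₁ (Matrix.diagonal dV₁)
    (complexConj_imagUnit L) (imagUnit_ne_zero L) (imagUnit_mul_self L) (realDiagonal_isSymm L dV₁ hdV₁)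
    (isUnit_det_realDiagonal L dV₁ hdV₁ hdV₁0) (realDiagonal_map L dV₁ hdV₁).symm (realDiagonal_lineW L TW)
    (diagonal_lineW L TW hJW) (realDiagonal_isSymm L _ (complexConj_lineW L TW)) hW
    (isUnit_det_realDiagonal L _ (complexConj_lineW L TW) (lineW_ne_zero L TW hWd)) hWd
    (realDiagonal_map L _ (complexConj_lineW L TW)).symm hJW
    (isCompatible_chiSplitting L e₁ dV₁ hdV₁ hdV₁0 (lineW L TW) (complexConj_lineW L TW) (lineW_ne_zero L TW hWd)
      χ hχu hχs)

/-- **the pair splitting of `s_χ` at the line is continuous** (`U(diag dV)(𝔸) × U(J_W)(𝔸) →* Mp_ψ(𝕎_𝔸)ᶜᵒⁿᵗ`).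
[cite: GelbartRogawski1991, §3.1 Prop. 3.1.1 p. 455 L1–3] -/
theorem continuous_pairSplitting_chiSplittingLine (χ : HeckeCharacter L) (hχu : χ.IsUnitary)
    (hχs : IsSplittingChar L 1 χ) (TW : Matrix (Fin 1) (Fin 1) (Fp L)) (hWd : IsUnit TW.det)
    (JW : Matrix (Fin 1) (Fin 1) L) (hJW : JW = TW.map (algebraMap (Fp L) L)) :
    Continuous (pairSplitting (Fp L) L (IsCMField.complexConj L) N' 1 e₁ (Matrix.diagonal dV₁) JW
      (chiSplittingLine L e₁ dV₁ hdV₁ hdV₁0 χ hχu hχs TW hWd JW hJW)) :=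
  continuous_pairSplitting_splittingCongr (Fp L) L (IsCMField.complexConj L) N' 1 e₁ (Matrix.diagonal dV₁)
    (realDiagonal_lineW L TW) (diagonal_lineW L TW hJW)
    (continuous_pairSplitting_chiSplitting L e₁ dV₁ hdV₁ hdV₁0 (lineW L TW) (complexConj_lineW L TW)
      (lineW_ne_zero L TW hWd) χ hχu hχs)

/-- `s_χ` at the line is continuous. [cite: GelbartRogawski1991, §3.1 Prop. 3.1.1 p. 455 L1–3] -/
theorem continuous_chiSplittingLine (χ : HeckeCharacter L) (hχu : χ.IsUnitary) (hχs : IsSplittingChar L 1 χ)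
    (TW : Matrix (Fin 1) (Fin 1) (Fp L)) (hWd : IsUnit TW.det) (JW : Matrix (Fin 1) (Fin 1) L)
    (hJW : JW = TW.map (algebraMap (Fp L) L)) :
    Continuous (chiSplittingLine L e₁ dV₁ hdV₁ hdV₁0 χ hχu hχs TW hWd JW hJW) :=
  continuous_splittingCongr (Fp L) L (IsCMField.complexConj L) N' 1 e₁ (Matrix.diagonal dV₁)
    (realDiagonal_lineW L TW) (diagonal_lineW L TW hJW)
    (continuous_chiSplitting L e₁ dV₁ hdV₁ hdV₁0 (lineW L TW) (complexConj_lineW L TW) (lineW_ne_zero L TW hWd)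
      χ hχu hχs)

end Line

end CM

end Literature.NumberTheory.Automorphic.Liu2021.Def411WeilCarriersDoubling


end
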